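import Summits.AtomisticToContinuum.Crystallization.Theorems.OverbindingBudgetAffineFarCoreWindowsA

/-!
# «FarCoreWindows» (lens-4 g65, 31280 GEN-37 (F) far core: layer coordinates, registry-free layer sums, Fubini, windows, Z2-S assembly, rows (N♯)/(X4)/(SC), Gram certificate, pattern-map leaf, finite window data) — part 2 of 4 (sequel of `…OverbindingBudgetAffineFarCoreWindowsA`)

Split for the 400-line cap by the landing lane (hand-2 g30); the module docstring of part 1 (`…OverbindingBudgetAffineFarCoreWindowsA`) describes the whole node.  Same namespace; all FQNs unchanged.
0 sorry; standard axioms.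
-/


namespace Summit.AtomisticToContinuum.Crystallization.Theorems.OverbindingBudgetAffineFarSmoothSplit

open scoped BigOperators Classical
open Literature.MathematicalPhysics.StatisticalMechanics
open Literature.Geometry.DiscreteGeometry (fccTwoShellPattern hcpTwoShellPattern)

local notation "E3" => EuclideanSpace ℝ (Fin 3)

/-! ## §4 Windows and the window sums -/

/-- The SIGN WINDOW of a sequence: `(s(−3), s(−2), s(−1), s(0), s(1), s(2))` — the data determining layers `−3 … 3` of the stacking. -/
def windowOf (s : ℤ → ℤ) : Fin 6 → ℤ := fun i => s (((i : ℕ) : ℤ) - 3)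

/-- The label of layer `k ∈ [−3, 3]` a sign window determines (`ℓ(0) = 0`, `ℓ(k+1) = ℓ(k) + s(k)`); `0` outside the window. -/
def windowLabel (w : Fin 6 → ℤ) (k : ℤ) : ℤ :=
  if k = 1 then w 3 else if k = 2 then w 3 + w 4 else if k = 3 then w 3 + w 4 + w 5
  else if k = -1 then -w 2 else if k = -2 then -(w 2 + w 1) else if k = -3 then -(w 2 + w 1 + w 0) else 0

/-- Inside the window the stacking's labels ARE the window labels. [this file] -/
theorem haggLabel_eq_windowLabel (s : ℤ → ℤ) {k : ℤ} (hk : |k| ≤ 3) : haggLabel s k = windowLabel (windowOf s) k := by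
  have h1 := haggLabel_succ s 0
  have h2 := haggLabel_succ s 1
  have h3 := haggLabel_succ s 2
  have hm1 := haggLabel_succ s (-1)
  have hm2 := haggLabel_succ s (-2)
  have hm3 := haggLabel_succ s (-3)
  norm_num at h1 h2 h3 hm1 hm2 hm3
  have e0 : windowOf s 0 = s (-3) := rfl
  have e1 : windowOf s 1 = s (-2) := rfl
  have e2 : windowOf s 2 = s (-1) := rfl
  have e3 : windowOf s 3 = s 0 := rfl
  have e4 : windowOf s 4 = s 1 := rfl
  have e5 : windowOf s 5 = s 2 := rfl
  have hk' := abs_le.mp hk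
  rcases (by omega : k = 1 ∨ k = 2 ∨ k = 3 ∨ k = -1 ∨ k = -2 ∨ k = -3 ∨ k = 0) with rfl | rfl | rfl | rfl | rfl | rfl | rfl
  · simp only [windowLabel, e3]; norm_num; linarith
  · simp only [windowLabel, e3, e4]; norm_num; linarith
  · simp only [windowLabel, e3, e4, e5]; norm_num; linarith
  · simp only [windowLabel, e2]; norm_num; linarith
  · simp only [windowLabel, e2, e1]; norm_num; linarith
  · simp only [windowLabel, e2, e1, e0]; norm_num; linarith
  · simp [windowLabel]

/-- UPPER layer function of a window: the exact layer sum for `|k| ≤ 3`, the coset MAX for `|k| > 3`. -/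
noncomputable def layerUp (w : Fin 6 → ℤ) (B : E3 →ₗ[ℝ] E3) (n : ℕ) (k : ℤ) : ℝ :=
  if |k| ≤ 3 then layerSum B n k (windowLabel w k) else max (layerSum B n k 0) (max (layerSum B n k 1) (layerSum B n k 2))

/-- LOWER layer function of a window: the exact layer sum for `|k| ≤ 3`, the coset MIN for `|k| > 3`. -/
noncomputable def layerLo (w : Fin 6 → ℤ) (B : E3 →ₗ[ℝ] E3) (n : ℕ) (k : ℤ) : ℝ :=
  if |k| ≤ 3 then layerSum B n k (windowLabel w k) else min (layerSum B n k 0) (min (layerSum B n k 1) (layerSum B n k 2))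

/-- The WINDOW SUM `T₃↑(w, B) = Σ'_k layerUp w B 6 k` — an upper bound for `shapeSix` of every chart with window `w` and linear part `B`. -/
noncomputable def windowSixUp (w : Fin 6 → ℤ) (B : E3 →ₗ[ℝ] E3) : ℝ := ∑' k : ℤ, layerUp w B 6 k

/-- The WINDOW SUM `T₆↓(w, B) = Σ'_k layerLo w B 12 k` — a lower bound for `shapeTwelve` of every chart with window `w` and linear part `B`. -/
noncomputable def windowTwelveLo (w : Fin 6 → ℤ) (B : E3 →ₗ[ℝ] E3) : ℝ := ∑' k : ℤ, layerLo w B 12 k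

/-- `layerUp_nonneg` (docstring added by the landing lane; see the module docstring). [formal bookkeeping] -/
theorem layerUp_nonneg (w : Fin 6 → ℤ) (B : E3 →ₗ[ℝ] E3) (n : ℕ) (k : ℤ) : 0 ≤ layerUp w B n k := by
  unfold layerUp
  split_ifs
  · exact layerSum_nonneg _ _ _ _
  · exact (layerSum_nonneg _ _ _ _).trans (le_max_left _ _)

/-- `layerLo_nonneg` (docstring added by the landing lane; see the module docstring). [formal bookkeeping] -/
theorem layerLo_nonneg (w : Fin 6 → ℤ) (B : E3 →ₗ[ℝ] E3) (n : ℕ) (k : ℤ) : 0 ≤ layerLo w B n k := by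
  unfold layerLo
  split_ifs
  · exact layerSum_nonneg _ _ _ _
  · exact le_min (layerSum_nonneg _ _ _ _) (le_min (layerSum_nonneg _ _ _ _) (layerSum_nonneg _ _ _ _))

/-- Pointwise: the chart's layer sum is below the window's upper layer function. [this file] -/
theorem layerSum_le_layerUp (s : ℤ → ℤ) (B : E3 →ₗ[ℝ] E3) (n : ℕ) (k : ℤ) :
    layerSum B n k (haggLabel s k) ≤ layerUp (windowOf s) B n k := by
  unfold layerUp
  split_ifs with hk
  · rw [haggLabel_eq_windowLabel s hk]
  · exact layerSum_le_max₃ B n k _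

/-- Pointwise: the window's lower layer function is below the chart's layer sum. [this file] -/
theorem layerLo_le_layerSum (s : ℤ → ℤ) (B : E3 →ₗ[ℝ] E3) (n : ℕ) (k : ℤ) :
    layerLo (windowOf s) B n k ≤ layerSum B n k (haggLabel s k) := by
  unfold layerLo
  split_ifs with hk
  · rw [haggLabel_eq_windowLabel s hk]
  · exact min₃_le_layerSum B n k _

/-- The far coset max is dominated by the majorant layer: `|k| > 3 ⇒ max₃ layerSum B 6 k {0,1,2} ≤ (1−m)⁻⁶ Σ' geomFiber k` (and `12`). [this file] -/
theorem max₃_layerSum_le {B : E3 →ₗ[ℝ] E3} {m : ℝ} (hm : m ≤ 1 / 6) (hB : ∃ Q : E3 →ₗᵢ[ℝ] E3, ∀ v, ‖B v - Q v‖ ≤ m * ‖v‖)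
    {k : ℤ} (hk : 3 < |k|) :
    max (layerSum B 6 k 0) (max (layerSum B 6 k 1) (layerSum B 6 k 2)) ≤ (1 - m)⁻¹ ^ 6 * ∑' ij : ℤ × ℤ, geomFiber k ij ∧
      max (layerSum B 12 k 0) (max (layerSum B 12 k 1) (layerSum B 12 k 2)) ≤ (1 - m)⁻¹ ^ 12 * ∑' ij : ℤ × ℤ, geomFiber k ij := by
  have hk2 : 2 ≤ |k| := (lt_trans (by norm_num) hk).le
  have h0 : |(0:ℤ)| ≤ |k| := by rw [abs_zero]; exact abs_nonneg k
  have h1 : |(1:ℤ)| ≤ |k| := by rw [abs_one]; exact le_trans (by norm_num) hk2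
  have h2 : |(2:ℤ)| ≤ |k| := by rw [abs_two]; exact hk2
  exact ⟨max_le (layerSum_far_le hm hB h0 hk2).1 (max_le (layerSum_far_le hm hB h1 hk2).1 (layerSum_far_le hm hB h2 hk2).1),
    max_le (layerSum_far_le hm hB h0 hk2).2 (max_le (layerSum_far_le hm hB h1 hk2).2 (layerSum_far_le hm hB h2 hk2).2)⟩

/-- **The window sums are genuine series**: `k ↦ layerUp (windowOf s) B 6 k` and `k ↦ layerLo (windowOf s) B 12 k` are summable for a Hägg sequence `s`
and `B` within `m ≤ 1/6` of an isometry (window layers: the chart's own layer sums; far layers: the majorant). [this file] -/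
theorem summable_layerUp_layerLo {s : ℤ → ℤ} (hs : IsHaggSeq s) {B : E3 →ₗ[ℝ] E3} {m : ℝ} (hm : m ≤ 1 / 6)
    (hB : ∃ Q : E3 →ₗᵢ[ℝ] E3, ∀ v, ‖B v - Q v‖ ≤ m * ‖v‖) :
    Summable (fun k : ℤ => layerUp (windowOf s) B 6 k) ∧ Summable (fun k : ℤ => layerLo (windowOf s) B 12 k) := by
  obtain ⟨hS6, hS12, -, -⟩ := summable_layerSum_chart hs hm hB
  have hG := summable_tsum_geomFiber
  refine ⟨?_, ?_⟩
  · -- `0 ≤ layerUp ≤ (own layer sum) + (1−m)⁻⁶ · majorant layer`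
    refine Summable.of_nonneg_of_le (fun k => layerUp_nonneg _ _ _ _) (fun k => ?_) (hS6.add (hG.mul_left ((1 - m)⁻¹ ^ 6)))
    have hG0 : 0 ≤ (1 - m)⁻¹ ^ 6 * ∑' ij : ℤ × ℤ, geomFiber k ij := by
      have : 0 < 1 - m := by linarith
      exact mul_nonneg (by positivity) (tsum_nonneg fun ij => geomFiber_nonneg k ij)
    unfold layerUp
    split_ifs with hk
    · rw [haggLabel_eq_windowLabel s hk]
      linarith
    · have := (max₃_layerSum_le hm hB (not_le.mp hk)).1
      linarith [layerSum_nonneg B 6 k (haggLabel s k)]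
  · refine Summable.of_nonneg_of_le (fun k => layerLo_nonneg _ _ _ _) (fun k => layerLo_le_layerSum s B 12 k) hS12

/-- ★ **`shapeSix c ≤ T₃↑(windowOf c.s, c.B)`** for a `θ`-admissible chart, `θ ≤ 1/18`. [this file] -/
theorem shapeSix_le_windowSixUp {θ : ℝ} (hθ : θ ≤ 1 / 18) {c : Chart} (hc : ChartAdmissible θ c) :
    shapeSix c ≤ windowSixUp (windowOf c.s) c.B := by
  obtain ⟨hs, -, -, hB, -⟩ := hc
  have hm : 3 * θ ≤ 1 / 6 := by linarith
  obtain ⟨hS6, -, -, -⟩ := summable_layerSum_chart hs hm hB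
  rw [shapeSix_eq_tsum_layerSum c hs hm hB]
  exact hS6.tsum_le_tsum (fun k => layerSum_le_layerUp c.s c.B 6 k) (summable_layerUp_layerLo hs hm hB).1

/-- ★ **`T₆↓(windowOf c.s, c.B) ≤ shapeTwelve c`** for a `θ`-admissible chart, `θ ≤ 1/18`. [this file] -/
theorem windowTwelveLo_le_shapeTwelve {θ : ℝ} (hθ : θ ≤ 1 / 18) {c : Chart} (hc : ChartAdmissible θ c) :
    windowTwelveLo (windowOf c.s) c.B ≤ shapeTwelve c := by
  obtain ⟨hs, -, -, hB, -⟩ := hc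
  have hm : 3 * θ ≤ 1 / 6 := by linarith
  obtain ⟨-, hS12, -, -⟩ := summable_layerSum_chart hs hm hB
  rw [shapeTwelve_eq_tsum_layerSum c hs hm hB]
  exact (summable_layerUp_layerLo hs hm hB).2.tsum_le_tsum (fun k => layerLo_le_layerSum c.s c.B 12 k) hS12

/-! ## §5 Assembly: Z2-S from per-window certificates -/

/-- `WindowGood θ θ₀ τ w B`: the pair (window, linear part) is realised by some `θ`-admissible, `(θ₀, τ)`-pattern-far chart — the region the
window table has to certify (to be coarsened to an explicit far-shape cell condition by `PatternFar ⇒ FarShape`). -/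
def WindowGood (θ θ₀ τ : ℝ) (w : Fin 6 → ℤ) (B : E3 →ₗ[ℝ] E3) : Prop :=
  ∃ c : Chart, ChartAdmissible θ c ∧ PatternFar θ₀ τ c ∧ c.B = B ∧ windowOf c.s = w

/-- A good window is a Hägg word: every sign is `±1`. [this file] -/
theorem windowGood_isHagg {θ θ₀ τ : ℝ} {w : Fin 6 → ℤ} {B : E3 →ₗ[ℝ] E3} (h : WindowGood θ θ₀ τ w B) (i : Fin 6) : w i = 1 ∨ w i = -1 := by
  obtain ⟨c, hc, -, -, rfl⟩ := h
  exact hc.1 _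

/-- A good linear part is within `3θ` of a linear isometry. [this file] -/
theorem windowGood_near {θ θ₀ τ : ℝ} {w : Fin 6 → ℤ} {B : E3 →ₗ[ℝ] E3} (h : WindowGood θ θ₀ τ w B) :
    ∃ Q : E3 →ₗᵢ[ℝ] E3, ∀ v, ‖B v - Q v‖ ≤ 3 * θ * ‖v‖ := by
  obtain ⟨c, hc, -, rfl, -⟩ := h
  exact hc.2.2.2.1

/-- A good pair comes with a pattern-far chart carrying exactly this window and linear part (for `PatternFar ⇒ FarShape`). [this file] -/
theorem windowGood_far {θ θ₀ τ : ℝ} {w : Fin 6 → ℤ} {B : E3 →ₗ[ℝ] E3} (h : WindowGood θ θ₀ τ w B) :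
    ∃ c : Chart, ChartAdmissible θ c ∧ PatternFar θ₀ τ c ∧ c.B = B ∧ windowOf c.s = w := h

/-- ★ **Z2-S from the window table**: if every good pair satisfies `T₃↑(w,B)² ≤ 24 Φ · T₆↓(w,B)` (`Φ ≥ 0`, `θ ≤ 1/18`) then `CoreFarShapeBound θ θ₀ Φ τ`. [this file] -/
theorem coreFarShapeBound_of_windowSums {θ θ₀ Φ τ : ℝ} (hθ : θ ≤ 1 / 18) (hΦ : 0 ≤ Φ)
    (hcert : ∀ w B, WindowGood θ θ₀ τ w B → windowSixUp w B ^ 2 ≤ 24 * Φ * windowTwelveLo w B) :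
    CoreFarShapeBound θ θ₀ Φ τ :=
  coreFarShapeBound_of_windows (WindowGood θ θ₀ τ) windowSixUp windowTwelveLo hΦ
    (fun c hc hfar => ⟨windowOf c.s, c.B, ⟨c, hc, hfar, rfl, rfl⟩, shapeSix_le_windowSixUp hθ hc, windowTwelveLo_le_shapeTwelve hθ hc⟩)
    hcert

/-- ★ **Record corollary**: at `(θ, θ₀, κ) = (1/25, 1/2000, 1/(2·10⁷))`, margin `10⁻⁹`, an hcp upper bound `u ≤ −(1/(2·10⁷) + 10⁻⁹)` and the WINDOW
TABLE at level `Φ = −(u + 1/(2·10⁷) + 10⁻⁹)` give Z2 `FarCoreExcess (1/25) (1/2000) (1/(2·10⁷))`. [this file] -/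
theorem farCoreExcess_record_of_windowSums {u τ : ℝ} (hτ : 0 < τ) (hU : HcpEnergyUpper u) (hu : u + 1 / (2 * 10 ^ 7) + 1 / 10 ^ 9 ≤ 0)
    (hcert : ∀ w B, WindowGood (1 / 25) (1 / 2000) τ w B →
      windowSixUp w B ^ 2 ≤ 24 * (-(u + 1 / (2 * 10 ^ 7) + 1 / 10 ^ 9)) * windowTwelveLo w B) :
    FarCoreExcess (1 / 25) (1 / 2000) (1 / (2 * 10 ^ 7)) :=
  farCoreExcess_record_of_certificate hτ hU (coreFarShapeBound_of_windowSums (by norm_num) (by linarith) hcert)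

/-! ## §6 Row (N♯): the sharpened non-far ball -/

/-- **(N♯) pointwise**.  Reference direction `v` (unit), nearest vector `s` (unit) with `μ = ‖X s‖`, `‖X − X₀‖ ≤ r`, `m := ⟪v, X₀ s⟫`,
`‖X₀ s − m v‖ ≤ γ`, `1/2 ≤ m − r`; for a two-shell vector `w` with `‖X₀ w − m w‖ ≤ δ`, growth term `‖(X−X₀) w − ⟪v,(X−X₀) s⟫ w‖ ≤ ℓ`, `‖w‖ ≤ n`:
`δ + ℓ + (γ + r)² n ≤ θ′(m − r)` ⇒ `‖X w − μ w‖ ≤ θ′ μ`.  (Versus row (N): the first-order growth of `μ` along `E = X − X₀` is subtracted exactly, only the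
second-order defect `μ − ⟪v, X s⟫ ≤ (γ + r)²` is paid.) [this file] -/
theorem norm_sub_smul_le_of_near_sharp {v s w : E3} {X X₀ : E3 →L[ℝ] E3} {μ θ' r γ δ ℓ n : ℝ} (hv : ‖v‖ = 1) (hs1 : ‖s‖ = 1)
    (hμ : μ = ‖X s‖) (hX : ‖X - X₀‖ ≤ r) (hγ : ‖X₀ s - (inner ℝ v (X₀ s)) • v‖ ≤ γ) (hhalf : 1 / 2 ≤ inner ℝ v (X₀ s) - r)
    (hδ : ‖X₀ w - (inner ℝ v (X₀ s)) • w‖ ≤ δ) (hℓ : ‖(X - X₀) w - (inner ℝ v ((X - X₀) s)) • w‖ ≤ ℓ) (hn : ‖w‖ ≤ n) (hθ : 0 ≤ θ')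
    (hrow : δ + ℓ + (γ + r) ^ 2 * n ≤ θ' * (inner ℝ v (X₀ s) - r)) : ‖X w - μ • w‖ ≤ θ' * μ := by
  -- name the quantities
  obtain ⟨q, hq⟩ : ∃ q : E3, (X - X₀) s = q := ⟨_, rfl⟩
  obtain ⟨m, hm⟩ : ∃ m : ℝ, inner ℝ v (X₀ s) = m := ⟨_, rfl⟩
  rw [hq] at hℓ
  rw [hm] at hγ hhalf hδ hrow
  obtain ⟨β, hβ⟩ : ∃ β : ℝ, inner ℝ v q = β := ⟨_, rfl⟩
  rw [hβ] at hℓ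
  have hXs : X s = X₀ s + q := by rw [← hq]; simp
  -- `|β| ≤ ‖q‖ ≤ r`
  have hqr : ‖q‖ ≤ r := by
    have h := ContinuousLinearMap.le_opNorm (X - X₀) s
    rw [hq, hs1, mul_one] at h
    exact h.trans hX
  have hβq : |β| ≤ ‖q‖ := by
    have h := abs_real_inner_le_norm v q
    rw [hv, one_mul, hβ] at h
    exact h
  have hr0 : 0 ≤ r := (norm_nonneg _).trans hqr
  have hγ0 : 0 ≤ γ := (norm_nonneg _).trans hγ
  -- `α := ⟪v, X s⟫ = m + β ≤ μ`
  have hα : inner ℝ v (X s) = m + β := by rw [hXs, inner_add_right, hm, hβ]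
  have hαμ : m + β ≤ μ := by
    have h := real_inner_le_norm v (X s)
    rw [hv, one_mul, hα, ← hμ] at h
    exact h
  have hβr : -r ≤ β := by have := (abs_le.mp hβq).1; linarith
  -- Pythagoras: `μ² = α² + ‖z‖²`, `z = X s − α v ⊥ v`, `‖z‖ ≤ γ + r`
  obtain ⟨z, hz⟩ : ∃ z : E3, X s - (m + β) • v = z := ⟨_, rfl⟩
  have hvz : inner ℝ v z = 0 := by
    rw [← hz, inner_sub_right, hα, real_inner_smul_right, real_inner_self_eq_norm_sq, hv]; ring
  have hμsq : μ ^ 2 = (m + β) ^ 2 + ‖z‖ ^ 2 := by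
    have e : X s = (m + β) • v + z := by rw [← hz]; abel
    have h := norm_add_sq_real ((m + β) • v) z
    rw [← e, real_inner_smul_left, hvz, mul_zero, mul_zero, add_zero, norm_smul, Real.norm_eq_abs, hv, mul_one, sq_abs] at h
    rw [hμ, h]
  have hzle : ‖z‖ ≤ γ + r := by
    have e : z = (X₀ s - m • v) + (q - β • v) := by rw [← hz, hXs, add_smul]; abel
    have hqv : inner ℝ q v = β := by rw [real_inner_comm, hβ]
    have hqβ : ‖q - β • v‖ ≤ ‖q‖ := by
      have h := norm_sub_sq_real q (β • v)
      rw [real_inner_smul_right, hqv, norm_smul, Real.norm_eq_abs, hv, mul_one, sq_abs] at h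
      have h' : ‖q - β • v‖ ^ 2 ≤ ‖q‖ ^ 2 := by rw [h]; nlinarith [sq_nonneg β]
      exact (pow_le_pow_iff_left₀ (norm_nonneg _) (norm_nonneg _) two_ne_zero).1 h'
    rw [e]
    exact (norm_add_le _ _).trans (by linarith)
  -- the second-order defect `μ − α ≤ (γ + r)²`
  have hdef : μ - (m + β) ≤ (γ + r) ^ 2 := by
    have h1 : (μ - (m + β)) * (μ + (m + β)) = ‖z‖ ^ 2 := by nlinarith [hμsq]
    have h2 : ‖z‖ ^ 2 ≤ (γ + r) ^ 2 := pow_le_pow_left₀ (norm_nonneg _) hzle 2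
    have h3 : 1 ≤ μ + (m + β) := by linarith
    nlinarith
  -- `X w − μ w = (X₀ w − m w) + (E w − β w) + (α − μ) w`
  have hsplit : X w - μ • w = (X₀ w - m • w) + ((X - X₀) w - β • w) + ((m + β) - μ) • w := by
    have e : (X - X₀) w = X w - X₀ w := by simp
    rw [e]
    simp only [sub_smul, add_smul]
    abel
  have h3 : ‖X w - μ • w‖ ≤ δ + ℓ + (μ - (m + β)) * ‖w‖ := by
    rw [hsplit]
    refine (norm_add₃_le).trans ?_
    have hc : ‖((m + β) - μ) • w‖ = (μ - (m + β)) * ‖w‖ := by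
      rw [norm_smul, Real.norm_eq_abs, abs_of_nonpos (by linarith)]; ring
    rw [hc]
    linarith
  have h4 : (μ - (m + β)) * ‖w‖ ≤ (γ + r) ^ 2 * n :=
    mul_le_mul hdef hn (norm_nonneg _) (by positivity)
  have h5 : θ' * (m - r) ≤ θ' * μ := mul_le_mul_of_nonneg_left (by linarith) hθ
  linarith

/-- Row (N♯) data: for each candidate nearest index `i` the reference quantities `mlo_i ≤ ⟪v_i, X₀ s_i⟫` and `γ_i ≥ ‖X₀ s_i − ⟪v_i, X₀ s_i⟫ v_i‖`, and
per (two-shell vector `k`, index `i`) the defect `δ_{k,i} ≥ ‖X₀ w_k − ⟪v_i, X₀ s_i⟫ w_k‖` and the growth bound `ℓ_{k,i}`; plus norms `n_k ≥ ‖w_k‖`. -/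
structure NSharpRow where
  /-- lower bound for `⟪v_i, X₀ s_i⟫` -/
  mlo : ℚ
  /-- upper bound for `‖X₀ s_i − ⟪v_i, X₀ s_i⟫ v_i‖` -/
  γ : ℚ
  /-- per two-shell vector: `(δ_{k,i}, ℓ_{k,i}, n_k)` -/
  cells : List (ℚ × ℚ × ℚ)

/-- Row (N♯) kernel: `0 ≤ r`, `0 ≤ θ′`, and for every index `i`: `1/2 ≤ mlo_i − r` and `δ + ℓ + (γ_i + r)² n ≤ θ′ (mlo_i − r)` for every cell. -/
def nSharpCheck (θ' r : ℚ) (rows : List NSharpRow) : Bool :=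
  (0 ≤ r) && (0 ≤ θ') && rows.all fun ρ =>
    (1 / 2 ≤ ρ.mlo - r) && ρ.cells.all fun c => c.1 + c.2.1 + (ρ.γ + r) ^ 2 * c.2.2 ≤ θ' * (ρ.mlo - r)

/-- ★ **Row (N♯) soundness**: a passing kernel, the first shell `S` (unit vectors) with reference directions `V` (unit vectors), a shape `X` within
operator distance `r` of `X₀` with nearest distance `μ = min_i ‖X (S i)‖`, and — for every index `i` and two-shell vector `k` — the enclosures the row
claims (`mlo`, `γ`, `δ`, `ℓ`, `n`; the growth bound `ℓ` is about the actual `E = X − X₀`, supplied cell-wise by `norm_sum_smul_le`) ⇒ no `W k`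
witnesses `θ′`-farness: `‖X (W k) − μ • W k‖ ≤ θ′ μ`. [this file] -/
theorem nSharpCheck_sound {ι : Type*} {S V : ι → E3} (hS : ∀ i, ‖S i‖ = 1) (hV : ∀ i, ‖V i‖ = 1) {θ' r : ℚ} {rows : List NSharpRow}
    (hρ : nSharpCheck θ' r rows = true) (row : ι → Fin rows.length) {κ : Type*} (W : κ → E3)
    (cell : ∀ i, κ → Fin (rows.get (row i)).cells.length) {X X₀ : E3 →L[ℝ] E3} {μ : ℝ} (hX : ‖X - X₀‖ ≤ (r : ℝ))
    (hμeq : ∃ i, μ = ‖X (S i)‖)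
    (hmlo : ∀ i, ((rows.get (row i)).mlo : ℝ) ≤ inner ℝ (V i) (X₀ (S i)))
    (hγ : ∀ i, ‖X₀ (S i) - (inner ℝ (V i) (X₀ (S i))) • V i‖ ≤ ((rows.get (row i)).γ : ℝ))
    (hδ : ∀ i k, ‖X₀ (W k) - (inner ℝ (V i) (X₀ (S i))) • W k‖ ≤ (((rows.get (row i)).cells.get (cell i k)).1 : ℝ))
    (hℓ : ∀ i k, ‖(X - X₀) (W k) - (inner ℝ (V i) ((X - X₀) (S i))) • W k‖ ≤ (((rows.get (row i)).cells.get (cell i k)).2.1 : ℝ))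
    (hn : ∀ i k, ‖W k‖ ≤ (((rows.get (row i)).cells.get (cell i k)).2.2 : ℝ)) :
    ∀ k, ‖X (W k) - μ • W k‖ ≤ (θ' : ℝ) * μ := by
  intro k
  obtain ⟨i, hi⟩ := hμeq
  simp only [nSharpCheck, Bool.and_eq_true, decide_eq_true_eq, List.all_eq_true] at hρ
  obtain ⟨⟨hr, hθ⟩, hall⟩ := hρ
  obtain ⟨hhalf, hcells⟩ := hall (rows.get (row i)) (List.get_mem rows (row i))
  have hc := hcells ((rows.get (row i)).cells.get (cell i k)) (List.get_mem _ _)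
  have hθr : (0 : ℝ) ≤ θ' := by exact_mod_cast hθ
  have hhalf' : (1 : ℝ) / 2 ≤ ((rows.get (row i)).mlo : ℝ) - r := by
    have h : (((1 : ℚ) / 2 : ℚ) : ℝ) ≤ (((rows.get (row i)).mlo - r : ℚ) : ℝ) := by exact_mod_cast hhalf
    push_cast at h
    exact h
  have hc' : (((rows.get (row i)).cells.get (cell i k)).1 : ℝ) + (((rows.get (row i)).cells.get (cell i k)).2.1 : ℝ) +
      (((rows.get (row i)).γ : ℝ) + r) ^ 2 * (((rows.get (row i)).cells.get (cell i k)).2.2 : ℝ) ≤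
      (θ' : ℝ) * (((rows.get (row i)).mlo : ℝ) - r) := by exact_mod_cast hc
  have hr' : (0 : ℝ) ≤ r := by exact_mod_cast hr
  -- upgrade the row inequality from `mlo` to the true `m = ⟪v, X₀ s⟫` and from the claimed γ to the true one
  have hm := hmlo i
  have hn0 : (0 : ℝ) ≤ (((rows.get (row i)).cells.get (cell i k)).2.2 : ℝ) := (norm_nonneg _).trans (hn i k)
  refine norm_sub_smul_le_of_near_sharp (hV i) (hS i) hi hX (hγ i) (by linarith) (hδ i k) (hℓ i k) (hn i k) hθr ?_
  have hmono : (θ' : ℝ) * (((rows.get (row i)).mlo : ℝ) - r) ≤ (θ' : ℝ) * (inner ℝ (V i) (X₀ (S i)) - r) :=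
    mul_le_mul_of_nonneg_left (by linarith) hθr
  linarith

/-- **Cell bound for the growth term**: if `E = Σₐ tₐ • Eₐ` on the vectors involved, then
`‖E w − ⟪v, E s⟫ w‖ ≤ Σₐ |tₐ| ‖Eₐ w − ⟪v, Eₐ s⟫ w‖` (the table bounds the right side on the cell `|tₐ| ≤ r₀`; the sharper `σ_max` version is an
(SC)-type PSD certificate on the `3 × d` matrix of the `Eₐ w − ⟪v, Eₐ s⟫ w`). [this file] -/
theorem norm_sum_smul_le {d : ℕ} (t : Fin d → ℝ) (F : Fin d → E3 →L[ℝ] E3) {E : E3 →L[ℝ] E3} (hE : ∀ x, E x = ∑ a, t a • F a x)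
    (v s w : E3) : ‖E w - (inner ℝ v (E s)) • w‖ ≤ ∑ a, |t a| * ‖F a w - (inner ℝ v (F a s)) • w‖ := by
  have e : E w - (inner ℝ v (E s)) • w = ∑ a, t a • (F a w - (inner ℝ v (F a s)) • w) := by
    rw [hE w, hE s, inner_sum, Finset.sum_smul, ← Finset.sum_sub_distrib]
    refine Finset.sum_congr rfl fun a _ => ?_
    rw [real_inner_smul_right, smul_sub, smul_smul]
  rw [e]
  refine (norm_sum_le _ _).trans (le_of_eq (Finset.sum_congr rfl fun a _ => ?_))
  rw [norm_smul, Real.norm_eq_abs]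

/-- Demo row (N♯) (memo §0: the four c-aligned windows at `θ′ = 4.99·10⁻⁴`, ball radius `r = 1.75·10⁻⁴ ≥ r₀ = 1.728·10⁻⁴`; worst two-shell vector
`‖w‖ ≤ 1.4143` with reference defect `1.151·10⁻⁴` and growth `ℓ = 2.0 · r = 3.5·10⁻⁴`; `mlo = 1`, `γ = 10⁻⁸`): evaluated by `norm_num`.  (The crude row
(N) needs `δ + 2 r ‖w‖ + θ′ r ≤ θ′`, i.e. `r ≤ 1.357·10⁻⁴ < r₀` — it FAILS on these windows.) -/
example : nSharpCheck (499 / 1000000) (7 / 40000)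
    [⟨1, 1 / 10 ^ 8, [(1151 / 10000000, 7 / 20000, 14143 / 10000), (0, 7 / 20000, 14143 / 10000), (0, 7 / 20000, 1)]⟩] = true := by
  norm_num [nSharpCheck]

end Summit.AtomisticToContinuum.Crystallization.Theorems.OverbindingBudgetAffineFarSmoothSplit
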